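import Summits.ResolutionOfSingularities.ResolutionOfSingularities.Theorems.PurelyInseparableDim4ResConeSatelliteKeptLetters
import HarnessLib
import HarnessLib.Audit.Tags

/-!
# Purely inseparable four-folds — SATELLITE RIGIDITY ON A POWER-CONE TAIL WITH A TRANSVERSAL KEPT LETTER (`e_G = 3`): after a satellite the
# next step direction is PINNED to a line (cell `res-dim4-pi`, K2(p) lane, B rows structure; holder ruling g5-12 (c) GO)

[OURS · counted 0 · cell `res-dim4-pi` · K2(p) lane holder res-dim4-p-12 g5 (g5-11 «B-row structure (p-9)», g5-12 (c) GO); seat res-dim4-p-9 g5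
over its own `…SatelliteKeptLetters` (p714810) and `…PermanentConeLetter` (p713160).]  Nothing here proves any TAIL(p, d, 3), K2(p), K2(7) or
resolution of singularities in dimension ≥ 4 / characteristic `p` — NOT proved.  AI kernel work, weaker than expert review.

At `e_G = 2` a kept TRANSVERSAL letter forbids the next satellite (`not_isSatellite_of_transversal_kept`), which kills every permanent
transversal letter (`coneLetter_of_permanent`).  At `e_G = 3` (POWER cones, `V_k = resVertex (c k) = ker ℓ_k` of dimension `3`) the same
vectors no longer collide, but they leave NO ROOM: with a letter `z` kept at `k`, `k+1` and transversal at `k` (`∃ w ∈ V_k, w_z ≠ 0`), at a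
satellite pair `(k, k+1)` the three vectors `dir_k` (`(j k)`-coord `1`, `z`-coord `0`), `dir_{k+1}` (`(j k)`-coord `0`, `z`-coord `0`, in
`V_k` by (I2)) and `w` are a BASIS of `V_k`, so
* **`satellite_direction_mem_line_of_transversal_kept`** — every `v ∈ V_k` with `v_z = 0` and `v_{j k} = 0` is a multiple of `dir_{k+1}`:
  the line `V_k ⊓ H_z ⊓ H_{j k}` is `K·dir_{k+1}`.  READING: after a satellite the next blow-up of the tail has NO continuous freedom — its
  direction is the generator of a line fixed by `(V_k, z, j k)`; the chart `j (k+1)` is one of the ≤ 3 letters where that generator is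
  non-zero and the translation `b (k+1)` is determined by it;
* `resVertex_eq_span_of_transversal_kept_satellite` — the basis statement itself;
* §2 `translation_eq_zero_of_satellite_of_pair_kept` — pure bookkeeping, any `e_G`: with a PAIR of letters kept through the satellite,
  the satellite step is a pure CORNER step (`b (k+1) = 0`) — a frozen pair turns the tail into the two-slot game.
(One frozen letter, e = 3: by `coneLetter_of_succ` (p711866, any e) a permanent `z` is either a cone letter for ever — the power cone IS
`a·x_z^d` along the tail — or transversal from some time on, and then every later satellite is rigid in the above sense.)  NOT a kill.
[cite: CossartJannsenSaito2020, Thm. 3.10 (4), Thm. 3.14, Thm. 9.3]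
bears_on: LADDER-RESOLUTION:D157-DOOR2 (res-dim4-pi · K2(p) B rows · satellite rigidity e_G = 3).  Supports stmt-ResolutionOfSingularities-16155
(helper).
-/

set_option linter.dupNamespace false -- mandated namespace of this single-conjunct summit

noncomputable section

namespace Summit.ResolutionOfSingularities.ResolutionOfSingularities.Theorems.PIDim4

namespace ResCone

open MvPolynomial Finset
open Literature.AlgebraicGeometry.Resolution
open Literature.AlgebraicGeometry.Resolution.CentreBlowup
open Literature.AlgebraicGeometry.Resolution.Hauser2010
open Literature.AlgebraicGeometry.Resolution.HauserPerlega2019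
open PointBlowup (additiveSubspace direction)

variable {K : Type} [Field K] {p : ℕ} [Fact p.Prime] [DecidableEq K]

/-- **THE KERNEL OF A POWER CONE AT A SATELLITE WITH A TRANSVERSAL KEPT LETTER IS SPANNED BY `dir_k`, `dir_{k+1}` AND THE TRANSVERSAL
VECTOR** (`e_G = 3`).  Along a witnessed isolated above-floor `Step0 p` chain with `x^{r₀} ∣ F₀`, constant shade and `e_G = 3` from `k₀`, at a
satellite pair `(k, k+1)` with a letter `z` kept at `k` and `k+1` and a kernel vector `w` with `w_z ≠ 0`: `resVertex (c k)` is the span of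
`direction (j k) (b k)`, `direction (j (k+1)) (b (k+1))`, `w`. [OURS] [cite: CossartJannsenSaito2020, Thm. 3.10 (4), Thm. 9.3] -/
theorem resVertex_eq_span_of_transversal_kept_satellite {c : ℕ → State K} {j : ℕ → Fin 4} {b : ℕ → Fin 4 → K}
    (hc : ∀ k, IsIsolated p (c k).F ∧ Step0 p (c k) (c (k + 1))) (hw : FreeTail.IsWitnessedChain p c j b)
    (hr0 : ∀ e ∈ (c 0).F.support, (c 0).r ≤ e) (hfloor : ∀ k, ordZero (c k).F ≠ p) {k₀ : ℕ} {d : ℕ∞}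
    (hshade : ∀ k, k₀ ≤ k → (c k).shade = d) (he : ∀ k, k₀ ≤ k → Module.finrank K (resVertex (c k)) = 3)
    {k : ℕ} (hk : k₀ ≤ k) (hsat : FreeTail.IsSatellite j b k) {z : Fin 4} (hzj : z ≠ j k) (hzj' : z ≠ j (k + 1))
    (hbz : b k z = 0) (hbz' : b (k + 1) z = 0) {w : Fin 4 → K} (hwV : w ∈ resVertex (c k)) (hwz : w z ≠ 0) :
    resVertex (c k) = Submodule.span K (Set.range ![direction (j k) (b k), direction (j (k + 1)) (b (k + 1)), w]) := by
  classical
  have hd₀ : direction (j k) (b k) ∈ resVertex (c k) := chain_direction_mem_resVertex p hc hw hr0 hfloor hshade hk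
  have hd₁ : direction (j (k + 1)) (b (k + 1)) ∈ resVertex (c k) :=
    direction_succ_mem_resVertex_of_satellite hc hw hr0 hfloor hshade he hk hsat
  have hd₀z : direction (j k) (b k) z = 0 := by rw [direction_apply_of_ne hzj, hbz]
  have hd₁z : direction (j (k + 1)) (b (k + 1)) z = 0 := by rw [direction_apply_of_ne hzj', hbz']
  have hd₁j : direction (j (k + 1)) (b (k + 1)) (j k) = 0 := by rw [direction_apply_of_ne (Ne.symm hsat.1), hsat.2]
  have hind : LinearIndependent K ![direction (j k) (b k), direction (j (k + 1)) (b (k + 1)), w] := by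
    rw [Fintype.linearIndependent_iff]
    intro g hg i
    have hsum : ∀ t, g 0 * direction (j k) (b k) t + g 1 * direction (j (k + 1)) (b (k + 1)) t + g 2 * w t = 0 := by
      intro t
      have h := congrFun hg t
      simp only [Finset.sum_apply, Pi.smul_apply, smul_eq_mul, Fin.sum_univ_three, Pi.zero_apply] at h
      exact h
    have hg2 : g 2 = 0 := by
      have h := hsum z
      rw [hd₀z, hd₁z, mul_zero, mul_zero, zero_add, zero_add] at h
      exact (mul_eq_zero.mp h).resolve_right hwz
    have hg0 : g 0 = 0 := by
      have h := hsum (j k)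
      rwa [direction_apply_self, hd₁j, hg2, mul_one, mul_zero, zero_mul, add_zero, add_zero] at h
    have hg1 : g 1 = 0 := by
      have h := hsum (j (k + 1))
      rwa [hg0, hg2, direction_apply_self, zero_mul, mul_one, zero_mul, zero_add, add_zero] at h
    fin_cases i
    · exact hg0
    · exact hg1
    · exact hg2
  have hle : Submodule.span K (Set.range ![direction (j k) (b k), direction (j (k + 1)) (b (k + 1)), w]) ≤ resVertex (c k) := by
    rw [Submodule.span_le, Set.range_subset_iff]
    intro i
    fin_cases i
    · exact hd₀
    · exact hd₁
    · exact hwV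
  refine (Submodule.eq_of_le_of_finrank_le hle ?_).symm
  rw [finrank_span_eq_card hind, Fintype.card_fin, he k hk]

/-- **SATELLITE RIGIDITY WITH A TRANSVERSAL KEPT LETTER** (`e_G = 3`).  In the situation of
`resVertex_eq_span_of_transversal_kept_satellite`: every kernel vector `v ∈ resVertex (c k)` with `v_z = 0` and `v_{j k} = 0` is a multiple of
the next step direction — the line `resVertex (c k) ⊓ H_z ⊓ H_{j k}` is `K · direction (j (k+1)) (b (k+1))`.  So at a satellite the next
blow-up direction is pinned to a line determined by the current kernel, the kept letter and the current chart. [OURS]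
[cite: CossartJannsenSaito2020, Thm. 3.10 (4), Thm. 3.14, Thm. 9.3] -/
theorem satellite_direction_mem_line_of_transversal_kept {c : ℕ → State K} {j : ℕ → Fin 4} {b : ℕ → Fin 4 → K}
    (hc : ∀ k, IsIsolated p (c k).F ∧ Step0 p (c k) (c (k + 1))) (hw : FreeTail.IsWitnessedChain p c j b)
    (hr0 : ∀ e ∈ (c 0).F.support, (c 0).r ≤ e) (hfloor : ∀ k, ordZero (c k).F ≠ p) {k₀ : ℕ} {d : ℕ∞}
    (hshade : ∀ k, k₀ ≤ k → (c k).shade = d) (he : ∀ k, k₀ ≤ k → Module.finrank K (resVertex (c k)) = 3)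
    {k : ℕ} (hk : k₀ ≤ k) (hsat : FreeTail.IsSatellite j b k) {z : Fin 4} (hzj : z ≠ j k) (hzj' : z ≠ j (k + 1))
    (hbz : b k z = 0) (hbz' : b (k + 1) z = 0) (htr : ∃ w ∈ resVertex (c k), w z ≠ 0)
    {v : Fin 4 → K} (hv : v ∈ resVertex (c k)) (hvz : v z = 0) (hvj : v (j k) = 0) :
    ∃ t : K, v = t • direction (j (k + 1)) (b (k + 1)) := by
  classical
  obtain ⟨w, hwV, hwz⟩ := htr
  have hd₀z : direction (j k) (b k) z = 0 := by rw [direction_apply_of_ne hzj, hbz]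
  have hd₁z : direction (j (k + 1)) (b (k + 1)) z = 0 := by rw [direction_apply_of_ne hzj', hbz']
  have hd₁j : direction (j (k + 1)) (b (k + 1)) (j k) = 0 := by rw [direction_apply_of_ne (Ne.symm hsat.1), hsat.2]
  rw [resVertex_eq_span_of_transversal_kept_satellite hc hw hr0 hfloor hshade he hk hsat hzj hzj' hbz hbz' hwV hwz,
    Submodule.mem_span_range_iff_exists_fun] at hv
  obtain ⟨g, hg⟩ := hv
  have hsum : ∀ t, g 0 * direction (j k) (b k) t + g 1 * direction (j (k + 1)) (b (k + 1)) t + g 2 * w t = v t := by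
    intro t
    have h := congrFun hg t
    simp only [Finset.sum_apply, Pi.smul_apply, smul_eq_mul, Fin.sum_univ_three] at h
    exact h
  have hg2 : g 2 = 0 := by
    have h := hsum z
    rw [hd₀z, hd₁z, hvz, mul_zero, mul_zero, zero_add, zero_add] at h
    exact (mul_eq_zero.mp h).resolve_right hwz
  have hg0 : g 0 = 0 := by
    have h := hsum (j k)
    rwa [direction_apply_self, hd₁j, hg2, hvj, mul_one, mul_zero, zero_mul, add_zero, add_zero] at h
  refine ⟨g 1, ?_⟩
  funext t
  rw [← hsum t, hg0, hg2, zero_mul, zero_mul, zero_add, add_zero, Pi.smul_apply, smul_eq_mul]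

/-! ## 2. Frozen pair: every satellite step is a pure corner step (no kernel needed) -/

omit [Fact p.Prime] [DecidableEq K] in
/-- **WITH TWO LETTERS KEPT THROUGH A SATELLITE PAIR, THE SATELLITE STEP IS A PURE CORNER STEP** (pure bookkeeping, any `e_G`).  If
`z ≠ z′` are neither charted nor translated at the step `k + 1`, the pair `(k, k+1)` is a satellite (`j (k+1) ≠ j k`, `b (k+1) (j k) = 0`),
`j k ∉ {z, z′}`, and the chart coordinate of the translation vanishes as always (`b (k+1) (j (k+1)) = 0`), then `b (k+1) = 0`: the four
letters `z, z′, j k, j (k+1)` are pairwise distinct, hence all of `Fin 4`.  So on a tail with a frozen PAIR every satellite is a corner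
switch between the two active letters (holder's ROW B-LF structure sentence «frozen pair ⇒ two-slot game»). [OURS · bookkeeping]
[cite: HauserPerlega2019PRIMS, §2] -/
theorem translation_eq_zero_of_satellite_of_pair_kept {j : ℕ → Fin 4} {b : ℕ → Fin 4 → K} {k : ℕ}
    (hbj : b (k + 1) (j (k + 1)) = 0) (hsat : FreeTail.IsSatellite j b k) {z z' : Fin 4} (hzz' : z ≠ z')
    (hzj : z ≠ j k) (hz'j : z' ≠ j k) (hzj' : z ≠ j (k + 1)) (hz'j' : z' ≠ j (k + 1))
    (hbz : b (k + 1) z = 0) (hbz' : b (k + 1) z' = 0) : b (k + 1) = 0 := by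
  classical
  -- the four named letters exhaust `Fin 4`
  set S : Finset (Fin 4) := {z, z', j k, j (k + 1)} with hS
  have hcard : S.card = 4 := by
    rw [hS, Finset.card_insert_of_notMem, Finset.card_insert_of_notMem, Finset.card_pair hsat.1.symm]
    · simp only [Finset.mem_insert, Finset.mem_singleton, not_or]; exact ⟨hz'j, hz'j'⟩
    · simp only [Finset.mem_insert, Finset.mem_singleton, not_or]; exact ⟨hzz', hzj, hzj'⟩
  have hSuniv : S = Finset.univ := Finset.eq_univ_of_card S (by rw [hcard, Fintype.card_fin])
  funext i
  have hi : i ∈ S := by rw [hSuniv]; exact Finset.mem_univ i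
  rw [hS, Finset.mem_insert, Finset.mem_insert, Finset.mem_insert, Finset.mem_singleton] at hi
  rw [Pi.zero_apply]
  rcases hi with rfl | rfl | rfl | rfl
  · exact hbz
  · exact hbz'
  · exact hsat.2
  · exact hbj

end ResCone

end Summit.ResolutionOfSingularities.ResolutionOfSingularities.Theorems.PIDim4

end
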